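import Mathlib
import Summits.ValiantsHypothesis.ValiantsHypothesis.Theorems.BinomialElusiveNumericToPuiseux
import Summits.ValiantsHypothesis.ValiantsHypothesis.Theorems.BinomialElusiveBinomialCandidatePolarImmersiveAtInfinity

/-!
# Crux `BinomialElusive.BinomialCandidate` (stmt-ValiantsHypothesis-7392), line `registered`,
# skeleton v4 — stub `stub_infinityGlue`: a formal Laurent solution at the place over `x = ∞`

The registered stub `stub_infinityGlue` of the crux
`Summit.ValiantsHypothesis.ValiantsHypothesis.Theses.BinomialElusive.BinomialCandidate`:
if the binomial curve `x ↦ (x^{a_i} + x^{b_i})_i` is contained in the image of a QUADRATIC map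
`Γ : ℂ^s → ℂ^m` (`totalDegree (Γ i) ≤ 2`), then for some `N ≥ 1` there are formal Laurent series
`p ∈ ℂ((t))^s` with `Γ_i(p) = t^{-N a_i} + t^{-N b_i}` — the expansion of a dominating curve at a
place over `x = ∞` in a local parameter `t` with `x = t^{-N}`.

Proof (known mathematics; a reduction to the place over `x = 0`, which is the tree's
`Summit.ValiantsHypothesis.Theorems.numericToPuiseux_proof`, by HOMOGENISATION):

* `InfinityGlue.aeval_homogenisation` — with a new variable `u = X 0` and `y = X ∘ Fin.succ`,
  the polynomial `u² K + u L(y) + B(y)` built from the homogeneous pieces `Γ = K + L + B` of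
  degrees `0, 1, 2` (`PolarImmersive.eq_add_homogeneousComponent`) is "`u² Γ(y/u)`": evaluated at
  `(u, u q)` it gives `u² Γ(q)`, over any commutative `ℂ`-algebra (here `ℂ` and `ℂ((t))`).
* `stub_infinityGlue` — with `c > all a_i, b_i`, the curve
  `x ↦ (x^{2c} + x^{2c}, (x^{2c-a_i} + x^{2c-b_i})_i)` lies in the image of the map
  `(u, y) ↦ (u² + u², (u² Γ_i(y/u))_i)`: over `x ≠ 0` take `u = x^c`, `y = u η` with
  `Γ(η) = f(x⁻¹)`; over `x = 0` take `0`.  `numericToPuiseux_proof` gives `N ≥ 1` and Laurent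
  series `(P₀, P)` with `2 P₀² = 2 t^{2cN}` and `u²Γ(y/u)|_{(P₀, P)} = t^{N(2c-a_i)} + t^{N(2c-b_i)}`;
  so `P₀² = t^{2cN}` (coefficientwise), `P₀ ≠ 0`, and `p := P₀⁻¹ P` satisfies
  `t^{2cN} Γ_i(p) = t^{N(2c-a_i)} + t^{N(2c-b_i)}`, i.e. `Γ_i(p) = t^{-N a_i} + t^{-N b_i}`.

Mathlib only, plus the two tree files imported above.
-/

-- layout Summits/ValiantsHypothesis/ValiantsHypothesis forces the duplicated namespace component
set_option linter.dupNamespace false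

namespace Summit.ValiantsHypothesis.ValiantsHypothesis.Theorems.BinomialCandidateStubs

namespace InfinityGlue

/-- Homogeneity over an arbitrary commutative `ℂ`-algebra: `φ(u q) = u^n φ(q)` for `φ`
homogeneous of degree `n` (cf. `PolarImmersive.aeval_mul_of_isHomogeneous`, the case `ℂ((t))`). -/
theorem aeval_mul_of_isHomogeneous_algebra {k n : ℕ} {A : Type*} [CommRing A] [Algebra ℂ A]
    (φ : MvPolynomial (Fin k) ℂ) (hφ : φ.IsHomogeneous n) (u : A) (q : Fin k → A) :
    MvPolynomial.aeval (fun j => u * q j) φ = u ^ n * MvPolynomial.aeval q φ := by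
  conv_lhs => rw [φ.as_sum]
  conv_rhs => rw [φ.as_sum]
  rw [map_sum, map_sum, Finset.mul_sum]
  refine Finset.sum_congr rfl fun d hd => ?_
  rw [MvPolynomial.aeval_monomial, MvPolynomial.aeval_monomial, Finsupp.prod_pow,
    Finsupp.prod_pow]
  simp_rw [mul_pow]
  rw [Finset.prod_mul_distrib, Finset.prod_pow_eq_pow_sum, ← Finsupp.degree_eq_sum,
    Finsupp.degree_apply, ← hφ.degree_eq_sum_deg_support hd]
  ring

/-- **Homogenisation identity.**  For `Γ` of total degree `≤ 2` with homogeneous pieces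
`K + L + B` of degrees `0, 1, 2`, the polynomial `u² K + u L(y) + B(y)` in the variables
`(u, y) = (X 0, X ∘ Fin.succ)` ("`u² Γ(y/u)`") evaluates at `(u, u q)` to `u² Γ(q)`, over any
commutative `ℂ`-algebra. -/
theorem aeval_homogenisation {s : ℕ} {A : Type*} [CommRing A] [Algebra ℂ A]
    (Γ : MvPolynomial (Fin s) ℂ) (hΓ : Γ.totalDegree ≤ 2) (u : A) (q : Fin s → A) :
    MvPolynomial.aeval (Fin.cons u (fun j => u * q j) : Fin (s + 1) → A)
      (MvPolynomial.X 0 ^ 2 *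
            MvPolynomial.rename Fin.succ (MvPolynomial.homogeneousComponent 0 Γ) +
          MvPolynomial.X 0 * MvPolynomial.rename Fin.succ (MvPolynomial.homogeneousComponent 1 Γ) +
        MvPolynomial.rename Fin.succ (MvPolynomial.homogeneousComponent 2 Γ)) =
      u ^ 2 * MvPolynomial.aeval q Γ := by
  have hcomp : ((Fin.cons u (fun j => u * q j) : Fin (s + 1) → A) ∘ Fin.succ) = fun j => u * q j :=
    funext fun j => by simp only [Function.comp_apply, Fin.cons_succ]
  simp only [map_add, map_mul, map_pow, MvPolynomial.aeval_X, Fin.cons_zero,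
    MvPolynomial.aeval_rename, hcomp]
  rw [aeval_mul_of_isHomogeneous_algebra _ (MvPolynomial.homogeneousComponent_isHomogeneous 0 Γ),
    aeval_mul_of_isHomogeneous_algebra _ (MvPolynomial.homogeneousComponent_isHomogeneous 1 Γ),
    aeval_mul_of_isHomogeneous_algebra _ (MvPolynomial.homogeneousComponent_isHomogeneous 2 Γ)]
  conv_rhs => rw [PolarImmersive.eq_add_homogeneousComponent Γ hΓ]
  rw [map_add, map_add]
  ring

/-- The homogenisation identity over `ℂ`, for `MvPolynomial.eval`. -/
theorem eval_homogenisation {s : ℕ} (Γ : MvPolynomial (Fin s) ℂ) (hΓ : Γ.totalDegree ≤ 2)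
    (u : ℂ) (q : Fin s → ℂ) :
    MvPolynomial.eval (Fin.cons u (fun j => u * q j) : Fin (s + 1) → ℂ)
      (MvPolynomial.X 0 ^ 2 *
            MvPolynomial.rename Fin.succ (MvPolynomial.homogeneousComponent 0 Γ) +
          MvPolynomial.X 0 * MvPolynomial.rename Fin.succ (MvPolynomial.homogeneousComponent 1 Γ) +
        MvPolynomial.rename Fin.succ (MvPolynomial.homogeneousComponent 2 Γ)) =
      u ^ 2 * MvPolynomial.eval q Γ := by
  have h := aeval_homogenisation Γ hΓ u q
  rwa [MvPolynomial.aeval_eq_eval, MvPolynomial.aeval_eq_eval] at h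

end InfinityGlue

open InfinityGlue in
/-- **Stub `stub_infinityGlue`** (crux stmt-ValiantsHypothesis-7392, line `registered`,
skeleton v4): if the binomial curve `x ↦ (x^{a_i} + x^{b_i})_i` lies in the image of a quadratic
map `Γ : ℂ^s → ℂ^m`, then for some `N ≥ 1` there are Laurent series `p` with
`Γ_i(p) = t^{-N a_i} + t^{-N b_i}` (a formal solution at the place over `x = ∞`). -/
theorem stub_infinityGlue :
    ∀ (m s : ℕ) (a b : Fin m → ℕ) (Γ : Fin m → MvPolynomial (Fin s) ℂ), 0 < m →
      (∀ i, (Γ i).totalDegree ≤ 2) →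
      Set.range (fun x : ℂ => fun i : Fin m => x ^ a i + x ^ b i) ⊆
        Set.range (fun y : Fin s → ℂ => fun i : Fin m => MvPolynomial.eval y (Γ i)) →
      ∃ (N : ℕ) (p : Fin s → LaurentSeries ℂ), 0 < N ∧ ∀ i, MvPolynomial.aeval p (Γ i) =
        HahnSeries.single (-((N * a i : ℕ) : ℤ)) (1 : ℂ) + HahnSeries.single (-((N * b i : ℕ) : ℤ)) (1 : ℂ) := by
  intro m s a b Γ _ hΓ hsub
  classical
  -- an exponent bound `c > a i, b i`
  set c : ℕ := ∑ i, (a i + b i) + 1 with hc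
  have hac : ∀ i, a i < c ∧ b i < c := by
    intro i
    have h1 : a i + b i ≤ ∑ j, (a j + b j) :=
      Finset.single_le_sum (f := fun j => a j + b j) (fun j _ => Nat.zero_le _) (Finset.mem_univ i)
    omega
  -- the homogenised data: exponents `2c`, `2c - a i`, `2c - b i`; map `(u² + u², u² Γ(y/u))`
  set a' : Fin (m + 1) → ℕ := Fin.cons (2 * c) (fun i => 2 * c - a i) with ha'
  set b' : Fin (m + 1) → ℕ := Fin.cons (2 * c) (fun i => 2 * c - b i) with hb'
  set Γ' : Fin (m + 1) → MvPolynomial (Fin (s + 1)) ℂ :=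
    Fin.cons (MvPolynomial.X 0 ^ 2 + MvPolynomial.X 0 ^ 2) (fun i =>
      MvPolynomial.X 0 ^ 2 *
            MvPolynomial.rename Fin.succ (MvPolynomial.homogeneousComponent 0 (Γ i)) +
          MvPolynomial.X 0 *
            MvPolynomial.rename Fin.succ (MvPolynomial.homogeneousComponent 1 (Γ i)) +
        MvPolynomial.rename Fin.succ (MvPolynomial.homogeneousComponent 2 (Γ i))) with hΓ'
  -- containment of the homogenised curve in the image of the homogenised map
  have hsub' : Set.range (fun x : ℂ => fun i : Fin (m + 1) => x ^ a' i + x ^ b' i) ⊆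
      Set.range (fun y : Fin (s + 1) → ℂ => fun i : Fin (m + 1) => MvPolynomial.eval y (Γ' i)) := by
    rintro _ ⟨x, rfl⟩
    obtain ⟨y, hy⟩ : ∃ y : Fin s → ℂ, ∀ i,
        x ^ (2 * c) * MvPolynomial.eval y (Γ i) = x ^ (2 * c - a i) + x ^ (2 * c - b i) := by
      rcases eq_or_ne x 0 with rfl | hx
      · refine ⟨0, fun i => ?_⟩
        have := hac i
        rw [zero_pow (by omega : 2 * c ≠ 0), zero_mul, zero_pow (by omega : 2 * c - a i ≠ 0),
          zero_pow (by omega : 2 * c - b i ≠ 0), add_zero]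
      · obtain ⟨y, hy⟩ := hsub ⟨x⁻¹, rfl⟩
        refine ⟨y, fun i => ?_⟩
        have := hac i
        have hyi : MvPolynomial.eval y (Γ i) = x⁻¹ ^ a i + x⁻¹ ^ b i := congr_fun hy i
        rw [hyi, mul_add, inv_pow, inv_pow, ← pow_sub₀ _ hx (by omega : a i ≤ 2 * c),
          ← pow_sub₀ _ hx (by omega : b i ≤ 2 * c)]
    refine ⟨Fin.cons (x ^ c) (fun j => x ^ c * y j), ?_⟩
    funext i
    refine Fin.cases ?_ (fun i => ?_) i
    · simp only [hΓ', ha', hb', Fin.cons_zero, map_add, map_pow, MvPolynomial.eval_X]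
      ring
    · simp only [hΓ', ha', hb', Fin.cons_succ]
      rw [eval_homogenisation (Γ i) (hΓ i), ← pow_mul, mul_comm c 2, hy i]
  -- the Laurent solution over `x = 0` for the homogenised system
  obtain ⟨N, P, hN, hP⟩ := Summit.ValiantsHypothesis.Theorems.numericToPuiseux_proof (m + 1)
    (s + 1) a' b' Γ' (Nat.succ_pos m) hsub'
  -- coordinate `0`: `P 0 ^ 2 = t^{2cN}`, so `P 0 ≠ 0`
  have h0 := hP 0
  simp only [hΓ', ha', hb', Fin.cons_zero, map_add, map_pow, MvPolynomial.aeval_X] at h0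
  have hsq : P 0 ^ 2 = HahnSeries.single ((N * (2 * c) : ℕ) : ℤ) (1 : ℂ) := by
    ext g
    have hg := congrArg (fun z : LaurentSeries ℂ => z.coeff g) h0
    simp only [HahnSeries.coeff_add] at hg
    linear_combination hg / 2
  have hT0 : HahnSeries.single ((N * (2 * c) : ℕ) : ℤ) (1 : ℂ) ≠ 0 :=
    HahnSeries.single_ne_zero one_ne_zero
  have hP0 : P 0 ≠ 0 := by
    intro h
    rw [h, zero_pow two_ne_zero] at hsq
    exact hT0 hsq.symm
  -- the chart at infinity: `p = P₀⁻¹ P`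
  set p : Fin s → LaurentSeries ℂ := fun j => (P 0)⁻¹ * P (Fin.succ j) with hp
  have hPcons : (Fin.cons (P 0) (fun j => P 0 * p j) : Fin (s + 1) → LaurentSeries ℂ) = P := by
    funext j
    refine Fin.cases ?_ (fun j => ?_) j
    · simp only [Fin.cons_zero]
    · simp only [Fin.cons_succ, hp]
      rw [mul_inv_cancel_left₀ hP0]
  refine ⟨N, p, hN, fun i => ?_⟩
  have hi := hP (Fin.succ i)
  simp only [hΓ', ha', hb', Fin.cons_succ] at hi
  have key := aeval_homogenisation (Γ i) (hΓ i) (P 0) p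
  rw [hPcons] at key
  rw [key, hsq] at hi
  -- divide by `t^{2cN}`
  have hac' := hac i
  have e1 : -((N * (2 * c) : ℕ) : ℤ) + ((N * (2 * c - a i) : ℕ) : ℤ) = -((N * a i : ℕ) : ℤ) := by
    push_cast [Nat.cast_sub (by omega : a i ≤ 2 * c)]
    ring
  have e2 : -((N * (2 * c) : ℕ) : ℤ) + ((N * (2 * c - b i) : ℕ) : ℤ) = -((N * b i : ℕ) : ℤ) := by
    push_cast [Nat.cast_sub (by omega : b i ≤ 2 * c)]
    ring
  calc MvPolynomial.aeval p (Γ i)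
      = (HahnSeries.single ((N * (2 * c) : ℕ) : ℤ) (1 : ℂ))⁻¹ *
          (HahnSeries.single ((N * (2 * c) : ℕ) : ℤ) (1 : ℂ) * MvPolynomial.aeval p (Γ i)) := by
        rw [inv_mul_cancel_left₀ hT0]
    _ = HahnSeries.single (-((N * a i : ℕ) : ℤ)) (1 : ℂ) +
          HahnSeries.single (-((N * b i : ℕ) : ℤ)) (1 : ℂ) := by
        rw [hi, HahnSeries.inv_single, inv_one, mul_add, HahnSeries.single_mul_single,
          HahnSeries.single_mul_single, mul_one, e1, e2]

end Summit.ValiantsHypothesis.ValiantsHypothesis.Theorems.BinomialCandidateStubs
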